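import Summits.CriticalPhenomena.PercolationContinuityZ3.Theorems.Transplant.PlanarSkeletonBoxProd
import Summits.CriticalPhenomena.PercolationContinuityZ3.Theorems.Transplant.BoxProdSlabQuotient
import Summits.CriticalPhenomena.PercolationContinuityZ3.Theorems.Transplant.HeisenbergSlabAPeierls
import HarnessLib

/-!
# Benjamini–Schramm's Conjecture 4 for EVERY `X □ H₃(ℤ)` from the lane's general node alone
# (`X` connected, locally finite, quasi-transitive; no residue)

builds on p205010 (kernel theorem, internal audit signed; external expert review pending) — nothing in this file uses p205010.
Lane `prim-bschramm`, seat `prim-bschramm-p4` (gen 3; class map, memo `P4-GENERAL.md` §11.5), helper file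
(`--supports stmt-CriticalPhenomena-4575`).  Conditional on the GENERAL planar-skeleton node (`SamePWitnessOfSkeleton`, or its drop
form `SamePDropOfSkeleton`) — NOT on the product node `ThetaDropBoxProdZ2` (two-nodes guard, VERDICTS V63); the node is not claimed.

Twin of `BoxProdHeisenbergZ.lean` with the second factor the Heisenberg Cayley graph itself (`Literature…cayleyGraph`, skeleton
`heisSkeleton`).  The cylinders `X × heisCyl ℓ` of `X □ H₃` are THICK as soon as `X` is infinite (for `H₃` alone they are quasi-one-
dimensional and p208219 suffices); their strict subcriticality at `p_c(X □ H₃)` is the product slab–quotient criterion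
(`BoxProdSlabQuotient.lean`) fed with the `a`-slab data of `HeisenbergSlabA.lean` and `p_c(Σ_L) < 1` from the subdivided-grid Peierls
lemma (`HeisenbergSlabAPeierls.lean`).  Results: `bsConj4_boxProdHeisenberg_of_skeletonNode`, `bsConj4_boxProdHeisenberg_of_dropNode`
(growth dichotomy: Hutchcroft / amenable + Burton–Keane + Φ2).  Examples: `H₃(ℤ) × H₃(ℤ)`, `ℤ^k × H₃(ℤ)`, `G × H₃(ℤ)` for `G` of
intermediate growth — all 'node only'.
[cite: BenjaminiSchramm1996, Conj. 4 and §2] [cite: MartineauSevero2019, Cor. 2.2] [cite: Hutchcroft2016, Thm. 1] [cite: LyonsPeres2016, §6.1, Thm. 7.6]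
[cite: KozmaNitzan2024, §1 p. 2 (approach 1)] [cite: CheegerKleinerNaor2011, §1.1]
-/

noncomputable section

namespace Summit.CriticalPhenomena.PercolationContinuityZ3.Theorems.Transplant

open MeasureTheory Literature.Probability.Percolation Literature.Probability.LatticeModels
open Literature.Barriers.CriticalPhenomena (IsQuasiTransitive IsGraphAmenable HasExponentialGrowth countable_of_connected_of_locallyFinite)
open Literature.Geometry.MetricEmbeddings
open Summit.CriticalPhenomena.PercolationContinuityZ3.Theorems.SameP (heisCyl zero_mem_heisCyl)

variable {W : Type}

/-! ## §1 The product skeleton and its cylinders -/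

/-- **The planar skeleton of `X □ H₃(ℤ)`**: `φ` = abelianisation of the second factor. [cite: KozmaNitzan2024, §4 p. 15] -/
def boxProdHeisSkeleton (X : SimpleGraph W) (hq : IsQuasiTransitive X) : PlanarSkeleton (X □ cayleyGraph) :=
  heisSkeleton.boxProdLeft X hq

/-- Its base vertices have second coordinate `1 = (0,0,0)`. [folklore] -/
theorem snd_eq_zero_of_mem_boxProdHeisSkeleton_types (X : SimpleGraph W) (hq : IsQuasiTransitive X) {t : W × (ℤ × ℤ × ℤ)}
    (ht : t ∈ (boxProdHeisSkeleton X hq).types) : t.2 = (0, 0, 0) := by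
  have h := ((PlanarSkeleton.mem_types_boxProdLeft X hq heisSkeleton t).1 ht).2
  simpa [heisSkeleton] using h

/-- **Its cylinders at `(x, 1)` are `X × heisCyl ℓ`.** [folklore] -/
theorem boxProdHeisSkeleton_cyl (X : SimpleGraph W) (hq : IsQuasiTransitive X) (x : W) (ℓ : ℕ) :
    (boxProdHeisSkeleton X hq).cyl (x, ((0, 0, 0) : ℤ × ℤ × ℤ)) ℓ = (Set.univ : Set W) ×ˢ heisCyl ℓ := by
  rw [boxProdHeisSkeleton, PlanarSkeleton.cyl_boxProdLeft, ← heisSkeleton_cyl ℓ]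

/-! ## §2 Input Φ2 of the product skeleton at `p_c` -/

/-- The family of slab shifts of the `a`-slab of `H₃(ℤ)`. [folklore] -/
def heisSlabShifts (L : ℕ) : Set (heisSlabAGraph L ≃g heisSlabAGraph L) :=
  Set.range fun bc : ℤ × ℤ => heisSlabShift L bc.1 bc.2

/-- **The cylinders `X × heisCyl ℓ` of `X □ H₃(ℤ)` do not percolate at `p_c(X □ H₃(ℤ))`** (`X` connected, locally finite,
quasi-transitive). [cite: MartineauSevero2019, Cor. 2.2] -/
theorem boxProdHeis_cylSubcritical (X : SimpleGraph W) [X.LocallyFinite] (hc : X.Connected) (hq : IsQuasiTransitive X) (x : W) (ℓ : ℕ) :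
    theta ((X □ cayleyGraph).induce ((Set.univ : Set W) ×ˢ heisCyl ℓ))
      ⟨(x, ((0, 0, 0) : ℤ × ℤ × ℤ)), Set.mk_mem_prod (Set.mem_univ x) (zero_mem_heisCyl ℓ)⟩
      (criticalProbIOf (X □ cayleyGraph) (x, ((0, 0, 0) : ℤ × ℤ × ℤ))) = 0 := by
  classical
  have hL : 1 ≤ ℓ + 1 := Nat.le_add_left 1 ℓ
  have hN : 2 * ℓ + 1 < 2 * ℓ + 2 := Nat.lt_succ_self _
  have hN' : 2 * ℓ < 2 * ℓ + 2 := by omega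
  have hN0 : 2 * ℓ + 2 ≠ 0 := Nat.succ_ne_zero _
  refine theta_boxProd_induce_cyl_criticalProb_eq_zero X cayleyGraph (Γ := HBShift (2 * ℓ + 2)) (S := heisSlabA (ℓ + 1))
    hc hq (heisCyl_subset_heisSlabA (Nat.le_succ ℓ)) (hbShift_isActionByAut (2 * ℓ + 2) (ℓ + 1)) (hbShift_free hN0)
    (heisSlabAGraph_connected hL) (heisSlabAGraph_quasiTransitive (ℓ + 1)) ((heisSlabAReps (ℓ + 1)).subtype (· ∈ heisSlabA (ℓ + 1)))
    (heisSlabShifts (ℓ + 1)) ?_ ?_ (heisSlabAOrigin (ℓ + 1)) (criticalProb_heisSlabA_lt_one hL)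
    (fun _ _ hy hgy => eq_one_of_smul_mem_heisCyl hN' hy hgy) (fun _ _ _ hy hz h => eq_one_of_adj_smul_heisCyl hN hy hz h) x
    (zero_mem_heisCyl ℓ)
  · rintro τ ⟨⟨β, γ⟩, rfl⟩ g y
    exact heisSlabShift_smul β γ g y
  · intro y
    exact ⟨heisSlabShift (ℓ + 1) (-(y : ℤ × ℤ × ℤ).2.1) (-(y : ℤ × ℤ × ℤ).2.2), ⟨(-(y : ℤ × ℤ × ℤ).2.1, -(y : ℤ × ℤ × ℤ).2.2), rfl⟩,
      Finset.mem_subtype.2 (heisSlabShift_mem_reps (ℓ + 1) y)⟩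

/-- … packaged as input Φ2 of the product skeleton at `p_c` (at any vertex's critical density). [cite: MartineauSevero2019, Cor. 2.2] -/
theorem boxProdHeisSkeleton_cylSubcritical (X : SimpleGraph W) [X.LocallyFinite] (hc : X.Connected) (hq : IsQuasiTransitive X)
    (v : W × (ℤ × ℤ × ℤ)) : (boxProdHeisSkeleton X hq).CylSubcritical (criticalProbIOf (X □ cayleyGraph) v) := by
  haveI : Countable W := countable_of_connected_of_locallyFinite X hc v.1
  have hconn : (X □ cayleyGraph).Connected := hc.boxProd cayleyGraph_connected
  intro t' ht' ℓ
  obtain ⟨x', y'⟩ := t'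
  have hy' : y' = (0, 0, 0) := snd_eq_zero_of_mem_boxProdHeisSkeleton_types X hq ht'
  subst hy'
  rw [theta_induce_congr (X □ cayleyGraph) (boxProdHeisSkeleton_cyl X hq x' ℓ)]
  have hpc : criticalProbIOf (X □ cayleyGraph) v = criticalProbIOf (X □ cayleyGraph) (x', ((0, 0, 0) : ℤ × ℤ × ℤ)) :=
    Subtype.ext (criticalProb_eq_of_reachable _ (hconn.preconnected _ _))
  rw [hpc]
  exact boxProdHeis_cylSubcritical X hc hq x' ℓ

/-! ## §3 Conjecture 4 for `X □ H₃(ℤ)` from the node -/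

/-- **`θ_{X □ H₃(ℤ)}(v, p_c) = 0` at every vertex, from the general WITNESS node** (`X` connected, locally finite, quasi-transitive).
Conditional on `SamePWitnessOfSkeleton` only. [cite: BenjaminiSchramm1996, Conj. 4] [cite: Hutchcroft2016, Thm. 1]
[cite: KozmaNitzan2024, §1 p. 2 (approach 1)] -/
theorem bsConj4_boxProdHeisenberg_of_skeletonNode (hW : SamePWitnessOfSkeleton) (X : SimpleGraph W) [X.LocallyFinite]
    (hc : X.Connected) (hq : IsQuasiTransitive X) (v : W × (ℤ × ℤ × ℤ)) :
    theta (X □ cayleyGraph) v (criticalProbIOf (X □ cayleyGraph) v) = 0 := by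
  classical
  by_cases hg : HasExponentialGrowth X
  · exact theta_boxProd_criticalProb_eq_zero_of_expGrowth X cayleyGraph hc cayleyGraph_connected hq isQuasiTransitive_heisenberg hg v
  · have hconn : (X □ cayleyGraph).Connected := hc.boxProd cayleyGraph_connected
    haveI : Countable W := countable_of_connected_of_locallyFinite X hc v.1
    have ha : IsGraphAmenable (X □ cayleyGraph) :=
      isGraphAmenable_boxProd_of_polyGrowth X cayleyGraph hq isQuasiTransitive_heisenberg 4 ballVolume_heisenberg_le hg
    obtain ⟨t, ht, -⟩ := (boxProdHeisSkeleton X hq).frame v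
    have h0 : theta (X □ cayleyGraph) t (criticalProbIOf (X □ cayleyGraph) t) = 0 :=
      continuity_of_skeleton_amenable hW (X □ cayleyGraph) (boxProdHeisSkeleton X hq) hconn
        (isQuasiTransitive_boxProd hq isQuasiTransitive_heisenberg) ha t ht (boxProdHeisSkeleton_cylSubcritical X hc hq t)
    exact theta_criticalProbIOf_eq_zero_of_reachable (X □ cayleyGraph) (hconn.preconnected _ _) h0

/-- **… and from the general DROP node** (design (D)).  Conditional on `SamePDropOfSkeleton` only.
[cite: BenjaminiSchramm1996, Conj. 4] [cite: KozmaNitzan2024, §1 p. 2 (approach 1)] -/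
theorem bsConj4_boxProdHeisenberg_of_dropNode (hD : SamePDropOfSkeleton) (X : SimpleGraph W) [X.LocallyFinite]
    (hc : X.Connected) (hq : IsQuasiTransitive X) (v : W × (ℤ × ℤ × ℤ)) :
    theta (X □ cayleyGraph) v (criticalProbIOf (X □ cayleyGraph) v) = 0 := by
  classical
  by_cases hg : HasExponentialGrowth X
  · exact theta_boxProd_criticalProb_eq_zero_of_expGrowth X cayleyGraph hc cayleyGraph_connected hq isQuasiTransitive_heisenberg hg v
  · have hconn : (X □ cayleyGraph).Connected := hc.boxProd cayleyGraph_connected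
    haveI : Countable W := countable_of_connected_of_locallyFinite X hc v.1
    have ha : IsGraphAmenable (X □ cayleyGraph) :=
      isGraphAmenable_boxProd_of_polyGrowth X cayleyGraph hq isQuasiTransitive_heisenberg 4 ballVolume_heisenberg_le hg
    obtain ⟨t, ht, -⟩ := (boxProdHeisSkeleton X hq).frame v
    have h0 : theta (X □ cayleyGraph) t (criticalProbIOf (X □ cayleyGraph) t) = 0 :=
      continuity_of_skeleton_drop_amenable hD (X □ cayleyGraph) (boxProdHeisSkeleton X hq) hconn
        (isQuasiTransitive_boxProd hq isQuasiTransitive_heisenberg) ha t ht (boxProdHeisSkeleton_cylSubcritical X hc hq t)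
    exact theta_criticalProbIOf_eq_zero_of_reachable (X □ cayleyGraph) (hconn.preconnected _ _) h0

/-- **All hypotheses of Benjamini–Schramm's Conjecture 4 hold for `X □ H₃(ℤ)`** (connected, quasi-transitive, `p_c < 1`).
[cite: BenjaminiSchramm1996, Conj. 4 and §2] -/
theorem boxProdHeisenberg_conj4_hypotheses (X : SimpleGraph W) [X.LocallyFinite] (hc : X.Connected) (hq : IsQuasiTransitive X) (x : W) :
    (X □ cayleyGraph).Connected ∧ IsQuasiTransitive (X □ cayleyGraph) ∧
      criticalProb (X □ cayleyGraph) (x, ((0, 0, 0) : ℤ × ℤ × ℤ)) < 1 := by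
  haveI : Countable W := countable_of_connected_of_locallyFinite X hc x
  exact ⟨hc.boxProd cayleyGraph_connected, isQuasiTransitive_boxProd hq isQuasiTransitive_heisenberg,
    (criticalProb_boxProd_le_right X cayleyGraph x (0, 0, 0)).trans_lt criticalProb_heisenberg_lt_one⟩

end Summit.CriticalPhenomena.PercolationContinuityZ3.Theorems.Transplant

end
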